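import Summits.CriticalPhenomena.PercolationContinuityZ3.Theorems.PercNearOneGluingNoHeavyQuantGatedSliceMixLawExchange
import Summits.CriticalPhenomena.PercolationContinuityZ3.Theorems.PercNearOneGluingNoHeavyQuantLightTwoBlobFlow
import Summits.CriticalPhenomena.PercolationContinuityZ3.Theorems.PercNearOneGluingNoHeavyQuantSliceTwoRowRates
import HarnessLib

/-!
# QUANT lane R8, T-DEC, leg (III), blob case — `LawDec.GatedSliceMixLaw'` in REGIME B with the top EQUAL TO the weak-mid atom
# (`k₂ = h`): the POOLED USAGE INEQUALITY of the moved two-point law (Lemma U) — the blob move does not increase the `g`-averaged usage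
# of the split low into the mid `h`, and top-affordability of `{k₁, h; λ}` at its own mean

builds on p205010 (kernel theorem, internal audit signed; external expert review pending)

Support file (`--supports stmt-CriticalPhenomena-4575`), QUANT lane seat prim-quant-census-2 (gen 61), rung R8 of
`run/shared/lean/prim/quant/LADDER.md`.  Memo `run/shared/lean/prim/quant/prim-quant-census-2-g61/REGIME-B-TOP-G61.md`.  Theorems only
(no definitions), standard axioms, no sorries.  Tools: `usage_mid_eq` / `usage_eq_light'` / `usage_eq_heavy'` (closed forms of the usage
rate), `pairGate_mono_rho`, `pairGate_lt_one`.

THE SETTING (cell B-M of `GatedSliceMixLaw'` with `k₂ = h`; notation of `…QuantGatedSliceMixLawExchange`).  `t = S + ag(1−z)`, `ℓ = k₁ + a`,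
`P = P[μ₂] = z·δ₀ + m₁δ_{k₁} + m₁'δ_ℓ + m₂δ_h + m₂'δ_{h+a}` (`m₁ = (1−z)(1−λ)(1−g)`, `m₁' = (1−z)(1−λ)g`, `m₂ = (1−z)λ(1−g)`, `m₂' = (1−z)λg`,
`(1−z)((1−λ)k₁ + λh) = S`), `u = y/(1−y)` (giant rate), `U_d = usage y t j ℓ h`, `U₁ = usage y t j k₁ h`.

THE LEMMA (this file).  **`U_d·m₁' + min(u, U₁)·m₁ + u·z ≤ m₂ + m₂' = (1−z)λ`** — the three lows of `P`, each shipped at its CHEAPEST rate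
(the shifted low into the mid `h`, the unshifted low into the cheaper of `h` and the giant, the zero into the giant), fit into the POOLED
absorber mass of `P` (`pooled_cheap` when the pair `(k₁, h)` is light, `U₁ < u`; `pooled_dear` otherwise).  It is the `b = 1` member of the dual
family of `P`'s transportation problem; it does NOT say `P ∈ D` (the pool is split into a mid and a giant), but mixing in the weak-mid law
`W_h` — which supplies mid mass `(S/h)(1−g)` per unit at a giant cost `u(1 − S/h) − (S/h)g ≤ (S/h)(1−g)` (top-affordability `y·h ≤ S`) — turns it
into a flow of `θ·W_h + (1−θ)·P` whenever the mid demand exceeds `m₂` (companion `…QuantGatedSliceMixLawRegimeBTop`).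
PROOF (all by hand).  (1) `usage y S j k₁ h ≤ (S − k₁)/(h − S)` (`usage_le_share`: the pair `{k₁, h; λ}` is valid at its own mean when
`y·h ≤ S` — heavy side trivially, light side by `k₁(1−y)² + y(S − yh) ≥ 0`), so with the mean identity
`(1−z)(1−λ)(S − k₁)/(h−S) + z·S/(h−S) = (1−z)λ` and `u ≤ S/(h−S)` everything reduces to (2) **`g·U_d + (1−g)·min(u, U₁) ≤ usage y S j k₁ h`**
(`blob_usage_le_cheap` / `blob_usage_le_dear`): in the light metric `1 + usage(l, T) = (h − l)/((1−y)E(l,T))`, `E(l,T) = (1−y)l + (1+y)h − T`,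
this is a weighted-HARMONIC-mean inequality `g(D−a)/E_d + (1−g)D/E₁ ≤ D/E_S` (`D = h − k₁`) whose cleared form is an explicit sum of products of
nonnegative cell quantities (`E_S − D = yD − (S − 2k₁) ≥ 0`, `D − E₁`, `h − k₁ − a(1−z)`, `2h − S − (1−z)D`, `z`, `1 − g`, …); when
`(S − 2k₁) > y(h − k₁)` (the pair heavy even at target `S`) monotonicity of `usage` in `ρ` suffices.
EVIDENCE before the proof: exact census of the seat (code `quant/prim-quant-census-2-g61/code/`), 27 644 + 2 644 instances of the cell from two
independent generators, 0 exceptions to the pooled inequality; 300 cross-checked against arm-3 g64's exact LP.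

* `LawDec.usage_mid_le_of_rho_le` — usage of a mid pair is monotone in `ρ = (T − 2l)/(h − l)`.
* `LawDec.usage_le_share` — `usage y S j k h ≤ (S − k)/(h − S)` for `2k < S < h`, `y·h ≤ S`.
* `LawDec.blob_usage_le_cheap` — `g·usage y t j (k+a) h + (1−g)·usage y t j k h ≤ usage y S j k h` when `t − 2k ≤ y(h − k)`.
* `LawDec.blob_usage_le_dear` — `g·usage y t j (k+a) h + (1−g)·y/(1−y) ≤ usage y S j k h` when `y(h − k) ≤ t − 2k`.
* `LawDec.pooled_cheap`, `LawDec.pooled_dear` — the mass forms `U_d m₁' + U₁ m₁ + u z ≤ (1−z)λ`, `U_d m₁' + u m₁ + u z ≤ (1−z)λ`.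

[this work]; flow form / usage closed forms: prim-quant-stmt g22–g27, census-2 g54, lead g21 (this lane); cell map: arm-3 g63–g64, lead g31–g32,
typer g30.  Nothing here is cited as a published result.  The gluing rows served [cite: KozmaNitzan2024, Conjecture 3 (p. 15)]; product measure
[cite: Grimmett1999, §1.3 p. 10].
-/

noncomputable section

namespace Summit.CriticalPhenomena.PercolationContinuityZ3.Theorems

namespace Quant

open Finset

namespace LawDec

/-! ### Usage of a mid is monotone in `ρ` -/

/-- **usage of a mid pair is monotone in `ρ`**: for mids `h₁, h₂ ≤ j` with `(l₂, h₂)` a compatible low–mid pair at `T₂` (`2l₂ < T₂ < l₂ + h₂`)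
and `ρ₁ = (T₁ − 2l₁)/(h₁ − l₁) ≤ ρ₂ = (T₂ − 2l₂)/(h₂ − l₂)`: `usage x T₁ j l₁ h₁ ≤ usage x T₂ j l₂ h₂` (`0 < x < 1`). [this work] -/
theorem usage_mid_le_of_rho_le (x T₁ T₂ : ℝ) (j l₁ l₂ h₁ h₂ : ℕ) (hx0 : 0 < x) (hx1 : x < 1) (hh₁ : h₁ ≤ j) (hh₂ : h₂ ≤ j)
    (hlow₂ : 2 * (l₂ : ℝ) < T₂) (hcomp₂ : T₂ < (l₂ : ℝ) + h₂)
    (hρ : (T₁ - 2 * (l₁ : ℝ)) / ((h₁ : ℝ) - l₁) ≤ (T₂ - 2 * (l₂ : ℝ)) / ((h₂ : ℝ) - l₂)) :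
    usage x T₁ j l₁ h₁ ≤ usage x T₂ j l₂ h₂ := by
  have hn₁ : ¬ (j + 1 ≤ h₁) := by omega
  have hn₂ : ¬ (j + 1 ≤ h₂) := by omega
  simp only [usage, gateOf, if_neg hn₁, if_neg hn₂]
  have hle := pairGate_mono_rho x T₁ T₂ l₁ h₁ l₂ h₂ hx1.le hρ
  have hlt := pairGate_lt_one x T₂ l₂ h₂ hx0 hx1 hlow₂ hcomp₂
  have hs : 0 < 1 - pairGate x T₁ l₁ h₁ := by linarith
  have ht : 0 < 1 - pairGate x T₂ l₂ h₂ := by linarith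
  rw [div_le_div_iff₀ hs ht]
  nlinarith

/-! ### Top-affordability of one pair, in usage form -/

/-- **`usage y S j k h ≤ (S − k)/(h − S)`**: the low `k` (`2k < S`) of the two-point law `{k, h; λ}` of mean `S` ((1−λ)k + λh = S, so
`λ/(1−λ) = (S−k)/(h−S)`) fits into its top `h ≤ j` at target `S` as soon as `y·h ≤ S` (`0 < y < 1`, `S < h`) — Theorem A for one pair.  Heavy
metric: `(S−2k)/(k+h−S) ≤ (S−k)/(h−S)` by `k(h−k) ≥ 0`; light metric: the slack is `(h−k)(k(1−y)² + y(S − yh))`. [this work] -/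
theorem usage_le_share (y S : ℝ) (j k h : ℕ) (hy0 : 0 < y) (hy1 : y < 1) (hhj : h ≤ j) (hlow : 2 * (k : ℝ) < S) (hSh : S < (h : ℝ))
    (hyh : y * (h : ℝ) ≤ S) :
    usage y S j k h ≤ (S - k) / ((h : ℝ) - S) := by
  have hk0 : (0 : ℝ) ≤ k := Nat.cast_nonneg k
  have hcomp : S < (k : ℝ) + h := by linarith
  have hD : (0 : ℝ) < (h : ℝ) - k := by linarith
  have hhS : (0 : ℝ) < (h : ℝ) - S := by linarith
  rw [usage_mid_eq y S j k h hy0 hy1 hhj hlow hcomp]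
  refine max_le ?_ ?_
  · have hden : 0 < (k : ℝ) + h - S := by linarith
    rw [div_le_div_iff₀ hden hhS]
    nlinarith
  · have hE : 0 < (1 - y) * ((1 - y) * (k : ℝ) + (1 + y) * h - S) := by
      apply mul_pos (by linarith); nlinarith
    rw [div_le_div_iff₀ hE hhS]
    have key : 0 ≤ ((h : ℝ) - k) * ((k : ℝ) * (1 - y) ^ 2 + y * (S - y * h)) :=
      mul_nonneg hD.le (add_nonneg (mul_nonneg hk0 (sq_nonneg _)) (mul_nonneg hy0.le (by linarith)))
    nlinarith [key]

/-! ### The blob move does not increase the `g`-averaged usage of the split low into the mid `h` -/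

/-- **cheap case** (`(k, h)` light at target `t`: `t − 2k ≤ y(h − k)`; then `(k+a, h)` at `t` and `(k, h)` at `S` are light too).
`0 < y < 1`, `0 ≤ z ≤ 1`, `0 ≤ g ≤ 1`, `t = S + ag(1−z)`, `h ≤ j`, `2k < S < h`, `2(k+a) < t ≤ 2h`:
`g·usage y t j (k+a) h + (1−g)·usage y t j k h ≤ usage y S j k h`.  In the light metric `1 + usage(l,T) = (h−l)/((1−y)E(l,T))` with
`E(l,T) = (1−y)l + (1+y)h − T` this is `g(D−a)/E_d + (1−g)D/E₁ ≤ D/E_S` (`D = h−k`, `E_d = E₁ + (1−y)a`, `E_S = E₁ + ag(1−z)`), whose cleared form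
`D E_d E₁ − g(D−a)E_S E₁ − (1−g)D E_S E_d` equals `ag[(E_S − D)(2h − S − (1−z)D + D − ag(1−z)) + D((1−y)(D − a(1−z)) + z(D − ag(1−z)))] ≥ 0`. [this work] -/
theorem blob_usage_le_cheap (y z g S : ℝ) (j h a k : ℕ) (hy0 : 0 < y) (hy1 : y < 1) (hz0 : 0 ≤ z) (hz1 : z ≤ 1)
    (hg0 : 0 ≤ g) (hg1 : g ≤ 1) (hhj : h ≤ j) (hkS : 2 * (k : ℝ) < S) (hSh : S < (h : ℝ))
    (hllow : 2 * ((k + a : ℕ) : ℝ) < S + (a : ℝ) * g * (1 - z)) (hmid : S + (a : ℝ) * g * (1 - z) ≤ 2 * (h : ℝ))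
    (hcheap : S + (a : ℝ) * g * (1 - z) - 2 * (k : ℝ) ≤ y * ((h : ℝ) - k)) :
    g * usage y (S + (a : ℝ) * g * (1 - z)) j (k + a) h + (1 - g) * usage y (S + (a : ℝ) * g * (1 - z)) j k h
      ≤ usage y S j k h := by
  set t : ℝ := S + (a : ℝ) * g * (1 - z) with ht
  have hk0 : (0 : ℝ) ≤ k := Nat.cast_nonneg k
  have ha0 : (0 : ℝ) ≤ a := Nat.cast_nonneg a
  have h1y : 0 < 1 - y := by linarith
  have hagw : 0 ≤ (a : ℝ) * g * (1 - z) := mul_nonneg (mul_nonneg ha0 hg0) (by linarith)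
  have hagwa : (a : ℝ) * g * (1 - z) ≤ a := by nlinarith [mul_nonneg ha0 hg0]
  have hSt : S ≤ t := by rw [ht]; linarith
  have hD : (0 : ℝ) < (h : ℝ) - k := by linarith
  -- compatibilities and light conditions
  have hcompS : S < (k : ℝ) + h := by linarith
  have hcomp1 : t < (k : ℝ) + h := by nlinarith
  have hcompd : t < ((k + a : ℕ) : ℝ) + h := by push_cast; rw [ht]; linarith
  have hlightS : S - 2 * (k : ℝ) ≤ y * ((h : ℝ) - k) := by linarith
  have hlightd : t - 2 * ((k + a : ℕ) : ℝ) ≤ y * ((h : ℝ) - ((k + a : ℕ) : ℝ)) := by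
    -- (t − 2ℓ)(h − k) ≤ (t − 2k)(h − ℓ) ≤ y(h−k)(h−ℓ)  since t ≤ 2h
    push_cast at hllow ⊢
    have hDl : (0 : ℝ) < (h : ℝ) - (k + a) := by linarith
    have h1 : (t - 2 * ((k : ℝ) + a)) * ((h : ℝ) - k) ≤ (t - 2 * (k : ℝ)) * ((h : ℝ) - (k + a)) := by nlinarith
    have h2 : (t - 2 * (k : ℝ)) * ((h : ℝ) - (k + a)) ≤ y * ((h : ℝ) - k) * ((h : ℝ) - (k + a)) :=
      mul_le_mul_of_nonneg_right hcheap hDl.le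
    nlinarith
  rw [usage_eq_light' y t j (k + a) h hy0 hy1 hhj hllow hcompd hlightd,
    usage_eq_light' y t j k h hy0 hy1 hhj (by linarith) hcomp1 hcheap,
    usage_eq_light' y S j k h hy0 hy1 hhj hkS hcompS hlightS]
  -- the three denominators
  set Ed : ℝ := (1 - y) * (((k + a : ℕ) : ℝ)) + (1 + y) * h - t with hEd
  set E1 : ℝ := (1 - y) * (k : ℝ) + (1 + y) * h - t with hE1
  set ES : ℝ := (1 - y) * (k : ℝ) + (1 + y) * h - S with hES
  have hE1pos : 0 < E1 := by rw [hE1]; nlinarith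
  have hEdpos : 0 < Ed := by rw [hEd]; push_cast; nlinarith
  have hESpos : 0 < ES := by rw [hES]; nlinarith
  -- numerators: N = (h − l) − (1−y)E
  have nd : y ^ 2 * ((h : ℝ) - ((k + a : ℕ) : ℝ)) + (1 - y) * (t - 2 * ((k + a : ℕ) : ℝ)) = ((h : ℝ) - ((k + a : ℕ) : ℝ)) - (1 - y) * Ed := by
    rw [hEd]; ring
  have n1 : y ^ 2 * ((h : ℝ) - k) + (1 - y) * (t - 2 * (k : ℝ)) = ((h : ℝ) - k) - (1 - y) * E1 := by rw [hE1]; ring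
  have nS : y ^ 2 * ((h : ℝ) - k) + (1 - y) * (S - 2 * (k : ℝ)) = ((h : ℝ) - k) - (1 - y) * ES := by rw [hES]; ring
  rw [nd, n1, nS]
  -- the cleared inequality
  have hεnn : 0 ≤ ES - ((h : ℝ) - k) := by rw [hES]; nlinarith
  have hzD : 0 ≤ z * ((h : ℝ) - k) := mul_nonneg hz0 hD.le
  have hDagw : 0 ≤ ((h : ℝ) - k) - (a : ℝ) * g * (1 - z) := by push_cast at hllow; linarith
  have hDaw : 0 ≤ ((h : ℝ) - k) - (a : ℝ) * (1 - z) := by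
    push_cast at hllow
    have : (a : ℝ) * (1 - z) ≤ a := by nlinarith
    linarith
  have hY : 0 ≤ (2 * (h : ℝ) - S - (1 - z) * ((h : ℝ) - k)) + (((h : ℝ) - k) - (a : ℝ) * g * (1 - z)) := by
    linarith [hzD, hDagw]
  have hT2 : 0 ≤ (1 - y) * (((h : ℝ) - k) - (a : ℝ) * (1 - z)) + z * (((h : ℝ) - k) - (a : ℝ) * g * (1 - z)) :=
    add_nonneg (mul_nonneg h1y.le hDaw) (mul_nonneg hz0 hDagw)
  have key : 0 ≤ ((h : ℝ) - k) * Ed * E1 - g * (((h : ℝ) - k) - a) * ES * E1 - (1 - g) * ((h : ℝ) - k) * ES * Ed := by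
    have e : ((h : ℝ) - k) * Ed * E1 - g * (((h : ℝ) - k) - a) * ES * E1 - (1 - g) * ((h : ℝ) - k) * ES * Ed
        = (a : ℝ) * g * ((ES - ((h : ℝ) - k)) * ((2 * (h : ℝ) - S - (1 - z) * ((h : ℝ) - k)) + (((h : ℝ) - k) - (a : ℝ) * g * (1 - z)))
          + ((h : ℝ) - k) * ((1 - y) * (((h : ℝ) - k) - (a : ℝ) * (1 - z)) + z * (((h : ℝ) - k) - (a : ℝ) * g * (1 - z)))) := by
      rw [hEd, hE1, hES, ht]; push_cast; ring
    rw [e]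
    exact mul_nonneg (mul_nonneg ha0 hg0) (add_nonneg (mul_nonneg hεnn hY) (mul_nonneg hD.le hT2))
  -- back to fractions: RHS − LHS = key / ((1−y)·Ed·E1·ES)
  rw [← sub_nonneg]
  have hq : (((h : ℝ) - k) - (1 - y) * ES) / ((1 - y) * ES)
      - (g * ((((h : ℝ) - ((k + a : ℕ) : ℝ)) - (1 - y) * Ed) / ((1 - y) * Ed))
        + (1 - g) * ((((h : ℝ) - k) - (1 - y) * E1) / ((1 - y) * E1)))
      = (((h : ℝ) - k) * Ed * E1 - g * (((h : ℝ) - k) - a) * ES * E1 - (1 - g) * ((h : ℝ) - k) * ES * Ed)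
        / ((1 - y) * Ed * E1 * ES) := by
    push_cast
    field_simp
    ring
  rw [hq]
  exact div_nonneg key (by positivity)

/-- **dear case** (`y(h − k) ≤ t − 2k`: the pair `(k, h)` at target `t` is heavy or incompatible, so the unshifted low rides the giant at
`u = y/(1−y)`).  Same frame as `blob_usage_le_cheap`: `g·usage y t j (k+a) h + (1−g)·y/(1−y) ≤ usage y S j k h`.  If `(k, h)` is light at
target `S` the light-metric form is `g(D−a)/E_d + (1−g) ≤ D/E_S`, cleared `D E_d − g(D−a)E_S − (1−g)E_S E_d ≥ 0`, an explicit sum of products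
with `0 ≤ E_S − D ≤ ag(1−z)` and `E₁ ≤ D`; otherwise `y/(1−y) ≤ usage y S j k h` and monotonicity in `ρ`. [this work] -/
theorem blob_usage_le_dear (y z g S : ℝ) (j h a k : ℕ) (hy0 : 0 < y) (hy1 : y < 1) (hz0 : 0 ≤ z) (hz1 : z ≤ 1)
    (hg0 : 0 ≤ g) (hg1 : g ≤ 1) (hhj : h ≤ j) (hkS : 2 * (k : ℝ) < S) (hSh : S < (h : ℝ))
    (hllow : 2 * ((k + a : ℕ) : ℝ) < S + (a : ℝ) * g * (1 - z))
    (hdear : y * ((h : ℝ) - k) ≤ S + (a : ℝ) * g * (1 - z) - 2 * (k : ℝ)) :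
    g * usage y (S + (a : ℝ) * g * (1 - z)) j (k + a) h + (1 - g) * (y / (1 - y)) ≤ usage y S j k h := by
  set t : ℝ := S + (a : ℝ) * g * (1 - z) with ht
  have hk0 : (0 : ℝ) ≤ k := Nat.cast_nonneg k
  have ha0 : (0 : ℝ) ≤ a := Nat.cast_nonneg a
  have h1y : 0 < 1 - y := by linarith
  have hagw : 0 ≤ (a : ℝ) * g * (1 - z) := mul_nonneg (mul_nonneg ha0 hg0) (by linarith)
  have hagwa : (a : ℝ) * g * (1 - z) ≤ a := by nlinarith [mul_nonneg ha0 hg0]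
  have hSt : S ≤ t := by rw [ht]; linarith
  have hD : (0 : ℝ) < (h : ℝ) - k := by linarith
  have hcompS : S < (k : ℝ) + h := by linarith
  have hcompd : t < ((k + a : ℕ) : ℝ) + h := by push_cast; rw [ht]; linarith
  have hDl : (0 : ℝ) < (h : ℝ) - ((k + a : ℕ) : ℝ) := by push_cast; push_cast at hllow; linarith
  -- ρ_d ≤ ρ_S :  (t − 2ℓ)(h − k) ≤ (S − 2k)(h − ℓ)
  have hρdS : (t - 2 * ((k + a : ℕ) : ℝ)) * ((h : ℝ) - k) ≤ (S - 2 * (k : ℝ)) * ((h : ℝ) - ((k + a : ℕ) : ℝ)) := by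
    push_cast; rw [ht]; nlinarith [mul_nonneg ha0 hg0, mul_nonneg hagw ha0]
  by_cases hcase : S - 2 * (k : ℝ) ≤ y * ((h : ℝ) - k)
  · -- light at target S (regime y ≥ ρ_S): harmonic form
    have hlightd : t - 2 * ((k + a : ℕ) : ℝ) ≤ y * ((h : ℝ) - ((k + a : ℕ) : ℝ)) := by
      have h2 : (S - 2 * (k : ℝ)) * ((h : ℝ) - ((k + a : ℕ) : ℝ)) ≤ y * ((h : ℝ) - k) * ((h : ℝ) - ((k + a : ℕ) : ℝ)) :=
        mul_le_mul_of_nonneg_right hcase hDl.le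
      nlinarith
    rw [usage_eq_light' y t j (k + a) h hy0 hy1 hhj hllow hcompd hlightd,
      usage_eq_light' y S j k h hy0 hy1 hhj hkS hcompS hcase]
    set Ed : ℝ := (1 - y) * (((k + a : ℕ) : ℝ)) + (1 + y) * h - t with hEd
    set E1 : ℝ := (1 - y) * (k : ℝ) + (1 + y) * h - t with hE1
    set ES : ℝ := (1 - y) * (k : ℝ) + (1 + y) * h - S with hES
    have hEdpos : 0 < Ed := by rw [hEd]; push_cast; push_cast at hcompd; nlinarith
    have hESpos : 0 < ES := by rw [hES]; nlinarith
    have nd : y ^ 2 * ((h : ℝ) - ((k + a : ℕ) : ℝ)) + (1 - y) * (t - 2 * ((k + a : ℕ) : ℝ)) = ((h : ℝ) - ((k + a : ℕ) : ℝ)) - (1 - y) * Ed := by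
      rw [hEd]; ring
    have nS : y ^ 2 * ((h : ℝ) - k) + (1 - y) * (S - 2 * (k : ℝ)) = ((h : ℝ) - k) - (1 - y) * ES := by rw [hES]; ring
    rw [nd, nS]
    -- cell quantities: ε = E_S − D ∈ [0, ag(1−z)], E₁ ≤ D
    have hε0 : 0 ≤ ES - ((h : ℝ) - k) := by rw [hES]; nlinarith
    have hε1 : 0 ≤ (a : ℝ) * g * (1 - z) - (ES - ((h : ℝ) - k)) := by rw [hES]; rw [ht] at hdear; nlinarith
    have hE1D : 0 ≤ ((h : ℝ) - k) - E1 := by rw [hE1]; nlinarith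
    have hDaw : 0 ≤ ((h : ℝ) - k) - (a : ℝ) * (1 - z) * (1 - g) := by
      push_cast at hllow
      have h1 : (1 - z) * (1 - g) ≤ 1 := mul_le_one₀ (by linarith) (by linarith) (by linarith)
      have h2 : (a : ℝ) * ((1 - z) * (1 - g)) ≤ (a : ℝ) * 1 := mul_le_mul_of_nonneg_left h1 ha0
      have h3 : (a : ℝ) * (1 - z) * (1 - g) = (a : ℝ) * ((1 - z) * (1 - g)) := by ring
      rw [h3]; linarith
    have key : 0 ≤ ((h : ℝ) - k) * Ed - g * (((h : ℝ) - k) - a) * ES - (1 - g) * ES * Ed := by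
      have e : ((h : ℝ) - k) * Ed - g * (((h : ℝ) - k) - a) * ES - (1 - g) * ES * Ed
          = (ES - ((h : ℝ) - k)) * (1 - g) * (((h : ℝ) - k) - E1)
            + (1 - g) * ((h : ℝ) - k) * ((a : ℝ) * g * (1 - z) - (ES - ((h : ℝ) - k)))
            + (a : ℝ) * g * ((h : ℝ) - k) * z
            + (ES - ((h : ℝ) - k)) * (a : ℝ) * g
            + (a : ℝ) * (1 - y) * ((1 - g) * ((a : ℝ) * g * (1 - z) - (ES - ((h : ℝ) - k))) + g * (((h : ℝ) - k) - (a : ℝ) * (1 - z) * (1 - g))) := by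
        rw [hEd, hE1, hES, ht]; push_cast; ring
      rw [e]
      have h1g : 0 ≤ 1 - g := by linarith
      refine add_nonneg (add_nonneg (add_nonneg (add_nonneg ?_ ?_) ?_) ?_) ?_
      · exact mul_nonneg (mul_nonneg hε0 h1g) hE1D
      · exact mul_nonneg (mul_nonneg h1g hD.le) hε1
      · exact mul_nonneg (mul_nonneg (mul_nonneg ha0 hg0) hD.le) hz0
      · exact mul_nonneg (mul_nonneg hε0 ha0) hg0
      · exact mul_nonneg (mul_nonneg ha0 h1y.le) (add_nonneg (mul_nonneg h1g hε1) (mul_nonneg hg0 hDaw))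
    rw [← sub_nonneg]
    have hq : (((h : ℝ) - k) - (1 - y) * ES) / ((1 - y) * ES)
        - (g * ((((h : ℝ) - ((k + a : ℕ) : ℝ)) - (1 - y) * Ed) / ((1 - y) * Ed)) + (1 - g) * (y / (1 - y)))
        = (((h : ℝ) - k) * Ed - g * (((h : ℝ) - k) - a) * ES - (1 - g) * ES * Ed) / ((1 - y) * Ed * ES) := by
      push_cast
      field_simp
      ring
    rw [hq]
    exact div_nonneg key (by positivity)
  · -- heavy at target S: `y/(1−y) ≤ usage y S j k h` and monotonicity in ρ
    push Not at hcase
    have hFS : y / (1 - y) ≤ usage y S j k h := by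
      rw [usage_eq_heavy' y S j k h hy0 hy1 hhj hkS hcompS hcase.le]
      have hden : 0 < (k : ℝ) + h - S := by linarith
      rw [div_le_div_iff₀ h1y hden]
      linarith [hcase]
    have hUd : usage y t j (k + a) h ≤ usage y S j k h := by
      refine usage_mid_le_of_rho_le y t S j (k + a) k h h hy0 hy1 hhj hhj hkS hcompS ?_
      rw [div_le_div_iff₀ hDl hD]
      exact hρdS
    calc g * usage y t j (k + a) h + (1 - g) * (y / (1 - y))
        ≤ g * usage y S j k h + (1 - g) * usage y S j k h :=
          add_le_add (mul_le_mul_of_nonneg_left hUd hg0) (mul_le_mul_of_nonneg_left hFS (by linarith))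
      _ = usage y S j k h := by ring

/-! ### The pooled inequalities in mass form -/

/-- **POOLED INEQUALITY, cheap case**: with `m₁ = (1−z)(1−λ)(1−g)`, `m₁' = (1−z)(1−λ)g` and the mean identity `(1−z)(k₁ + (h − k₁)λ) = S`,
top-affordability `y·h ≤ S`, and `(k₁, h)` light at `t` (`t − 2k₁ ≤ y(h − k₁)`):
`usage y t j (k₁+a) h · m₁' + usage y t j k₁ h · m₁ + y/(1−y)·z ≤ (1−z)λ`. [this work] -/
theorem pooled_cheap (y z g S lam : ℝ) (j h a k₁ : ℕ) (hy0 : 0 < y) (hy1 : y < 1) (hz0 : 0 ≤ z) (hz1 : z ≤ 1)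
    (hg0 : 0 ≤ g) (hg1 : g ≤ 1) (hlam1 : lam ≤ 1) (hhj : h ≤ j) (hSh : S < (h : ℝ)) (hyh : y * (h : ℝ) ≤ S)
    (hmean : (1 - z) * ((k₁ : ℝ) + ((h : ℝ) - k₁) * lam) = S)
    (hllow : 2 * ((k₁ + a : ℕ) : ℝ) < S + (a : ℝ) * g * (1 - z)) (hmid : S + (a : ℝ) * g * (1 - z) ≤ 2 * (h : ℝ))
    (hcheap : S + (a : ℝ) * g * (1 - z) - 2 * (k₁ : ℝ) ≤ y * ((h : ℝ) - k₁)) :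
    usage y (S + (a : ℝ) * g * (1 - z)) j (k₁ + a) h * ((1 - z) * (1 - lam) * g)
      + usage y (S + (a : ℝ) * g * (1 - z)) j k₁ h * ((1 - z) * (1 - lam) * (1 - g)) + y / (1 - y) * z ≤ (1 - z) * lam := by
  have ha0 : (0 : ℝ) ≤ a := Nat.cast_nonneg a
  have hk0 : (0 : ℝ) ≤ k₁ := Nat.cast_nonneg k₁
  have h1y : 0 < 1 - y := by linarith
  have hhS : 0 < (h : ℝ) - S := by linarith
  have hagwa : (a : ℝ) * g * (1 - z) ≤ a := by nlinarith [mul_nonneg ha0 hg0]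
  have hkS : 2 * (k₁ : ℝ) < S := by push_cast at hllow; linarith
  have hm : 0 ≤ (1 - z) * (1 - lam) := mul_nonneg (by linarith) (by linarith)
  have hJ := blob_usage_le_cheap y z g S j h a k₁ hy0 hy1 hz0 hz1 hg0 hg1 hhj hkS hSh hllow hmid hcheap
  have hA := usage_le_share y S j k₁ h hy0 hy1 hhj hkS hSh hyh
  have hu : y / (1 - y) ≤ S / ((h : ℝ) - S) := by rw [div_le_div_iff₀ h1y hhS]; nlinarith
  have hid : (1 - z) * (1 - lam) * ((S - k₁) / ((h : ℝ) - S)) + S / ((h : ℝ) - S) * z = (1 - z) * lam := by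
    field_simp
    linear_combination (-1 : ℝ) * hmean
  calc usage y (S + (a : ℝ) * g * (1 - z)) j (k₁ + a) h * ((1 - z) * (1 - lam) * g)
        + usage y (S + (a : ℝ) * g * (1 - z)) j k₁ h * ((1 - z) * (1 - lam) * (1 - g)) + y / (1 - y) * z
      = (1 - z) * (1 - lam) * (g * usage y (S + (a : ℝ) * g * (1 - z)) j (k₁ + a) h
          + (1 - g) * usage y (S + (a : ℝ) * g * (1 - z)) j k₁ h) + y / (1 - y) * z := by ring
    _ ≤ (1 - z) * (1 - lam) * ((S - k₁) / ((h : ℝ) - S)) + S / ((h : ℝ) - S) * z :=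
        add_le_add (mul_le_mul_of_nonneg_left (hJ.trans hA) hm) (mul_le_mul_of_nonneg_right hu hz0)
    _ = (1 - z) * lam := hid

/-- **POOLED INEQUALITY, dear case** (`y(h − k₁) ≤ t − 2k₁`: the unshifted low rides the giant):
`usage y t j (k₁+a) h · m₁' + y/(1−y)·m₁ + y/(1−y)·z ≤ (1−z)λ`. [this work] -/
theorem pooled_dear (y z g S lam : ℝ) (j h a k₁ : ℕ) (hy0 : 0 < y) (hy1 : y < 1) (hz0 : 0 ≤ z) (hz1 : z ≤ 1)
    (hg0 : 0 ≤ g) (hg1 : g ≤ 1) (hlam1 : lam ≤ 1) (hhj : h ≤ j) (hSh : S < (h : ℝ)) (hyh : y * (h : ℝ) ≤ S)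
    (hmean : (1 - z) * ((k₁ : ℝ) + ((h : ℝ) - k₁) * lam) = S)
    (hllow : 2 * ((k₁ + a : ℕ) : ℝ) < S + (a : ℝ) * g * (1 - z))
    (hdear : y * ((h : ℝ) - k₁) ≤ S + (a : ℝ) * g * (1 - z) - 2 * (k₁ : ℝ)) :
    usage y (S + (a : ℝ) * g * (1 - z)) j (k₁ + a) h * ((1 - z) * (1 - lam) * g)
      + y / (1 - y) * ((1 - z) * (1 - lam) * (1 - g)) + y / (1 - y) * z ≤ (1 - z) * lam := by
  have ha0 : (0 : ℝ) ≤ a := Nat.cast_nonneg a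
  have hk0 : (0 : ℝ) ≤ k₁ := Nat.cast_nonneg k₁
  have h1y : 0 < 1 - y := by linarith
  have hhS : 0 < (h : ℝ) - S := by linarith
  have hagwa : (a : ℝ) * g * (1 - z) ≤ a := by nlinarith [mul_nonneg ha0 hg0]
  have hkS : 2 * (k₁ : ℝ) < S := by push_cast at hllow; linarith
  have hm : 0 ≤ (1 - z) * (1 - lam) := mul_nonneg (by linarith) (by linarith)
  have hJ := blob_usage_le_dear y z g S j h a k₁ hy0 hy1 hz0 hz1 hg0 hg1 hhj hkS hSh hllow hdear
  have hA := usage_le_share y S j k₁ h hy0 hy1 hhj hkS hSh hyh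
  have hu : y / (1 - y) ≤ S / ((h : ℝ) - S) := by rw [div_le_div_iff₀ h1y hhS]; nlinarith
  have hid : (1 - z) * (1 - lam) * ((S - k₁) / ((h : ℝ) - S)) + S / ((h : ℝ) - S) * z = (1 - z) * lam := by
    field_simp
    linear_combination (-1 : ℝ) * hmean
  calc usage y (S + (a : ℝ) * g * (1 - z)) j (k₁ + a) h * ((1 - z) * (1 - lam) * g)
        + y / (1 - y) * ((1 - z) * (1 - lam) * (1 - g)) + y / (1 - y) * z
      = (1 - z) * (1 - lam) * (g * usage y (S + (a : ℝ) * g * (1 - z)) j (k₁ + a) h + (1 - g) * (y / (1 - y))) + y / (1 - y) * z := by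
        ring
    _ ≤ (1 - z) * (1 - lam) * ((S - k₁) / ((h : ℝ) - S)) + S / ((h : ℝ) - S) * z :=
        add_le_add (mul_le_mul_of_nonneg_left (hJ.trans hA) hm) (mul_le_mul_of_nonneg_right hu hz0)
    _ = (1 - z) * lam := hid

end LawDec

end Quant

end Summit.CriticalPhenomena.PercolationContinuityZ3.Theorems
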